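import Summits.ResolutionOfSingularities.ResolutionOfSingularities.Theorems.WeightedInvariantIota3Sigma
import HarnessLib

/-!
# Two-flag filtrations at RATIO `r₁/r₂ > 2`: the level-`2r₁` piece lies in `(g₁²) + g₁·𝔪³ + 𝔪⁵` (structure lemma for order-2 σ-bounds)

Route `ResolutionOfSingularities/WeightedInvariant`, door crux `HypersurfaceCentreConstruction` (stmt-ResolutionOfSingularities-19897), P3 rung;
ORDER (o50) of res-L1-w43-plan-1 (K-wild-hom), kernel item «K1 certificate», piece (C1) = the flag-general half of memo
`plan/tools/res-type-060/o50/K-WILD-HOM.md` §4 (res-type-060, gen 10).  [OURS · L1 W4.3 · helper, counted 0] — elementary ideal arithmetic in any local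
ring over res-type-073's `Iota3.flagContactFiltration` (p-file `…Iota3Sigma`); nothing here is a statement of the manuscript under review (Hironaka 2017)
or of [ATW2024] as printed.  AI proof, weaker than expert review.

* `Iota3.flagContactFiltration_two_le_of_two_mul_lt` — for `g₂ ∈ 𝔪`, an admissible-type triple with `q ≤ r₂` and `2·r₂ < r₁` (RATIO `> 2`):
  `flagContactFiltration g₁ g₂ q r₁ r₂ (r₁·2) ≤ (g₁²) ⊔ (g₁)·𝔪³ ⊔ 𝔪⁵`.
  Reading: if an order-`2` germ `f` REACHES a triple of ratio `> 2` along `(g₁, g₂)`, then `f ≡ a·g₁² (mod g₁𝔪³ + 𝔪⁵)`: its tangent quadric is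
  `a(0)·ḡ₁²` (rank one, a SQUARE direction) and its degree-`≤ 4` jet is controlled by `g₁` — the opening move of every «no flag reaches ratio `> 2`»
  certificate (memo §4: K1's orbit-generic successor `X² + YZ⁴ + Y⁷T⁴`, where the degree-4 form `Y(Z̄² + Y³T̄²)²` would have to be a square times a
  square scalar, impossible as `√Y ∉ κ(η)`; piece (C2) to follow in the completed model).
* `Iota3.mem_sup_sup_iff` — bookkeeping: membership in `(g₁²) ⊔ (g₁)·𝔪³ ⊔ 𝔪⁵` as `f = a·g₁² + g₁·b + c`, `b ∈ 𝔪³`, `c ∈ 𝔪⁵`.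
-/

noncomputable section

open IsLocalRing

set_option linter.dupNamespace false -- mandated namespace of this single-conjunct summit

namespace Summit.ResolutionOfSingularities.ResolutionOfSingularities.Cruxes.HypersurfaceCentreConstruction.LocalEngine

namespace Iota3

variable {S : Type} [CommRing S] [IsLocalRing S]

/-- Arithmetic of the `α = 0` pieces at ratio `> 2`: `β + ⌈(2r₁ − r₂β)/q⌉ ≥ 5`. [folklore] -/
theorem five_le_add_ceil_of_two_mul_lt {q r₁ r₂ : ℕ} (hq : 0 < q) (hqr : q ≤ r₂) (hr : 2 * r₂ < r₁) (β : ℕ) :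
    5 ≤ β + (r₁ * 2 - r₁ * 0 - r₂ * β + q - 1) / q := by
  by_cases hβ : 5 ≤ β
  · exact hβ.trans (Nat.le_add_right _ _)
  · have key : 5 - β ≤ (r₁ * 2 - r₁ * 0 - r₂ * β + q - 1) / q := by
      rw [Nat.le_div_iff_mul_le hq]
      interval_cases β
      · omega
      · omega
      · omega
      · omega
      · omega
    omega

/-- Arithmetic of the `α = 1` pieces at ratio `> 2`: `β + ⌈(r₁ − r₂β)/q⌉ ≥ 3`. [folklore] -/
theorem three_le_add_ceil_of_two_mul_lt {q r₁ r₂ : ℕ} (hq : 0 < q) (hqr : q ≤ r₂) (hr : 2 * r₂ < r₁) (β : ℕ) :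
    3 ≤ β + (r₁ * 2 - r₁ * 1 - r₂ * β + q - 1) / q := by
  by_cases hβ : 3 ≤ β
  · exact hβ.trans (Nat.le_add_right _ _)
  · have key : 3 - β ≤ (r₁ * 2 - r₁ * 1 - r₂ * β + q - 1) / q := by
      rw [Nat.le_div_iff_mul_le hq]
      interval_cases β
      · omega
      · omega
      · omega
    omega

/-- **THE LEVEL-`2r₁` PIECE OF A TWO-FLAG FILTRATION OF RATIO `> 2` LIES IN `(g₁²) + g₁·𝔪³ + 𝔪⁵`** (`g₂ ∈ 𝔪`, `0 < q ≤ r₂`, `2r₂ < r₁`).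
[OURS · L1 W4.3] -/
theorem flagContactFiltration_two_le_of_two_mul_lt (g₁ g₂ : S) (hg₂ : g₂ ∈ maximalIdeal S) {q r₁ r₂ : ℕ}
    (hq : 0 < q) (hqr : q ≤ r₂) (hr : 2 * r₂ < r₁) :
    flagContactFiltration g₁ g₂ q r₁ r₂ (r₁ * 2) ≤
      (Ideal.span {g₁ ^ 2} ⊔ Ideal.span {g₁} * maximalIdeal S ^ 3) ⊔ maximalIdeal S ^ 5 := by
  rw [flagContactFiltration_def]
  refine iSup_le fun α => iSup_le fun β => ?_
  have hg₂β : Ideal.span {g₂ ^ β} ≤ maximalIdeal S ^ β :=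
    (Ideal.span_singleton_le_iff_mem _).mpr (Ideal.pow_mem_pow hg₂ β)
  rcases Nat.lt_or_ge α 2 with hα | hα
  · interval_cases α
    · -- `α = 0`: the piece lies in `𝔪^{β + γ} ≤ 𝔪⁵`
      refine le_sup_of_le_right ?_
      rw [pow_zero, one_mul]
      calc Ideal.span {g₂ ^ β} * maximalIdeal S ^ ((r₁ * 2 - r₁ * 0 - r₂ * β + q - 1) / q)
          ≤ maximalIdeal S ^ β * maximalIdeal S ^ ((r₁ * 2 - r₁ * 0 - r₂ * β + q - 1) / q) := Ideal.mul_mono_left hg₂β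
        _ = maximalIdeal S ^ (β + (r₁ * 2 - r₁ * 0 - r₂ * β + q - 1) / q) := (pow_add _ _ _).symm
        _ ≤ maximalIdeal S ^ 5 := Ideal.pow_le_pow_right (five_le_add_ceil_of_two_mul_lt hq hqr hr β)
    · -- `α = 1`: the piece lies in `g₁ · 𝔪^{β + γ} ≤ g₁ · 𝔪³`
      refine le_sup_of_le_left (le_sup_of_le_right ?_)
      rw [pow_one, ← Ideal.span_singleton_mul_span_singleton, mul_assoc]
      refine Ideal.mul_mono_right ?_
      calc Ideal.span {g₂ ^ β} * maximalIdeal S ^ ((r₁ * 2 - r₁ * 1 - r₂ * β + q - 1) / q)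
          ≤ maximalIdeal S ^ β * maximalIdeal S ^ ((r₁ * 2 - r₁ * 1 - r₂ * β + q - 1) / q) := Ideal.mul_mono_left hg₂β
        _ = maximalIdeal S ^ (β + (r₁ * 2 - r₁ * 1 - r₂ * β + q - 1) / q) := (pow_add _ _ _).symm
        _ ≤ maximalIdeal S ^ 3 := Ideal.pow_le_pow_right (three_le_add_ceil_of_two_mul_lt hq hqr hr β)
  · -- `α ≥ 2`: the piece lies in `(g₁²)`
    refine le_sup_of_le_left (le_sup_of_le_left ?_)
    refine Ideal.mul_le_right.trans ?_
    exact Ideal.span_singleton_le_span_singleton.mpr ((pow_dvd_pow g₁ hα).mul_right _)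

/-- Bookkeeping: membership in `(g₁²) ⊔ (g₁)·𝔪³ ⊔ 𝔪⁵` unfolded. [folklore] -/
theorem mem_sup_sup_iff (g₁ f : S) :
    f ∈ (Ideal.span {g₁ ^ 2} ⊔ Ideal.span {g₁} * maximalIdeal S ^ 3) ⊔ maximalIdeal S ^ 5 ↔
      ∃ a b c : S, b ∈ maximalIdeal S ^ 3 ∧ c ∈ maximalIdeal S ^ 5 ∧ f = a * g₁ ^ 2 + g₁ * b + c := by
  constructor
  · intro h
    obtain ⟨y, hy, c, hc, rfl⟩ := Submodule.mem_sup.mp h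
    obtain ⟨x, hx, z, hz, rfl⟩ := Submodule.mem_sup.mp hy
    obtain ⟨a, rfl⟩ := Ideal.mem_span_singleton'.mp hx
    obtain ⟨b, hb, rfl⟩ := Ideal.mem_span_singleton_mul.mp hz
    exact ⟨a, b, c, hb, hc, by ring⟩
  · rintro ⟨a, b, c, hb, hc, rfl⟩
    refine Submodule.add_mem_sup (Submodule.add_mem_sup ?_ ?_) hc
    · exact Ideal.mem_span_singleton'.mpr ⟨a, rfl⟩
    · exact Ideal.mem_span_singleton_mul.mpr ⟨b, hb, rfl⟩

/-- **Corollary (reading for σ-bounds)**: if an order-2 germ reaches a triple of ratio `> 2` along a two-flag, it is `a·g₁² + g₁·b + c` with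
`b ∈ 𝔪³`, `c ∈ 𝔪⁵`. [OURS · L1 W4.3] -/
theorem exists_eq_of_mem_flagContactFiltration_two {g₁ g₂ f : S} (hg₂ : g₂ ∈ maximalIdeal S) {q r₁ r₂ : ℕ}
    (hq : 0 < q) (hqr : q ≤ r₂) (hr : 2 * r₂ < r₁) (hf : f ∈ flagContactFiltration g₁ g₂ q r₁ r₂ (r₁ * 2)) :
    ∃ a b c : S, b ∈ maximalIdeal S ^ 3 ∧ c ∈ maximalIdeal S ^ 5 ∧ f = a * g₁ ^ 2 + g₁ * b + c :=
  (mem_sup_sup_iff g₁ f).mp (flagContactFiltration_two_le_of_two_mul_lt g₁ g₂ hg₂ hq hqr hr hf)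

end Iota3

end Summit.ResolutionOfSingularities.ResolutionOfSingularities.Cruxes.HypersurfaceCentreConstruction.LocalEngine

end
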